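import Summits.ResolutionOfSingularities.ResolutionOfSingularities.Theses.HomologicalConductor
import Literature.RingTheory.CohomologyAnnihilator.AnnihilationOfCohomology
import Summits.ResolutionOfSingularities.ResolutionOfSingularities.Theorems.HomologicalConductorStrictDropRegularDrop
import Summits.ResolutionOfSingularities.ResolutionOfSingularities.Theorems.HomologicalConductorStrictDropTowerShape
import Summits.ResolutionOfSingularities.ResolutionOfSingularities.Theorems.HomologicalConductorStrictDropStationaryRegular
import Summits.ResolutionOfSingularities.ResolutionOfSingularities.Theorems.HomologicalConductorNoZenoIffKernel
import HarnessLib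

/-!
# Crux `StrictDrop` (stmt-ResolutionOfSingularities-16485), line `birth` — the ASSEMBLY, landed

Route `ResolutionOfSingularities/HomologicalConductor`, crux #4 `StrictDrop` (along the canonical
normalised cohomology-annihilator blow-up tower `T₀ = A_centre`,
`T_(m+1) = (normalisation of T_m[ca(T_m)/x])_centre` of a finitely generated `A ⊆ O ⊆ K = Frac A`,
while `T_m` is singular some later stage carries a non-zero annihilator of value strictly below
all of `ca(T_m) ∖ 0`).

This file records, sorry-free and definition-free (every statement is the route's `let`-telescope
verbatim, plus the line's `let Shape`), the COMPOSITION of the line `birth`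
(`Cruxes/StrictDrop/Lines/birth.lean`, lead's skeleton v3) now that its three calibration stubs
are landed:

* S0 `TowerShape.stub_towerShape` (p168403) — every stage has the tower `Shape`;
* SB `StationaryRegular.stub_stationary_regular` (p168965) — given Iyengar–Takahashi 2014
  Thm 5.4 (the tree's named fact `singEqVCa_essFiniteType`), a frozen stage is regular;
* SC `RegularDrop.stub_regular_drop` (p166871) — a regular stage drops the value below every
  non-zero annihilator of a singular stage.

Main results:

* `strictDrop_of_dropOrFreeze` — **`StrictDrop` follows from DROP-OR-FREEZE (the line's open stub
  `stub_dichotomy`, stated inline) and Iyengar–Takahashi 2014 Thm 5.4.** Pure logic over the three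
  landed stubs: at a singular stage `m`, drop-or-freeze hands over either the drop or a stationary
  stage `n ≥ m`; the latter is regular (SB), hence `n ≠ m`, and SC gives the witness at `n`.
* `dropOrFreeze_of_strictDrop` — the converse (left branch at singular stages; at regular stages
  the tower is stationary by the landed `NoZeno.Birth.tower_succ_eq_self_of_isRegularLocalRing`),
  so modulo the named fact the open stub IS the crux (`dropOrFreeze_iff_strictDrop`).

Consequently the crux is reduced to exactly its dynamical core ("the canonical tower does not grow
sideways forever at constant minimal conductor value") plus the literature debt IT14 Thm 5.4; by
the landed `NoZeno.Birth.stub_noetherianCase` (p167613) that core contains termination of the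
canonical tower along every discrete valuation ring, i.e. canonical local uniformization along
all divisorial and all other rank-one discrete valuations of function fields in characteristic
`p`, in every dimension.
-/

noncomputable section

-- single-problem summit: the doubled namespace component `ResolutionOfSingularities` is forced
set_option linter.dupNamespace false

open Summit.ResolutionOfSingularities.ResolutionOfSingularities.Theses.HomologicalConductor (StrictDrop)

namespace Summit.ResolutionOfSingularities.ResolutionOfSingularities.Theorems.StrictDrop.Birth.Assembly

/-- **`StrictDrop` from drop-or-freeze and Iyengar–Takahashi 2014 Thm 5.4.** The first hypothesis
is verbatim the registered (inlined) signature of the line's open stub `stub_dichotomy`: from every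
stage `m`, either the minimal `ca`-value drops strictly at a later stage or some stage `n ≥ m` is
stationary. The composition uses the three landed stubs S0 (`TowerShape.stub_towerShape`), SB
(`StationaryRegular.stub_stationary_regular`, which consumes the named fact) and SC
(`RegularDrop.stub_regular_drop`). [folklore] -/
theorem strictDrop_of_dropOrFreeze : (∀ p : ℕ, p.Prime → ∀ (k K : Type) [Field k] [CharP k p] [Field K] [Algebra k K] (O : ValuationSubring K) (A : Subalgebra k K), (∀ c : k, algebraMap k K c ∈ O) → A.FG → IsFractionRing ↥A K → A.toSubring ≤ O.toSubring → let ca : Subalgebra k K → Set K := fun A => {x : K | ∃ hx : x ∈ A, ∃ n : ℕ, ∀ i : ℕ, n ≤ i → ∀ (M N : ModuleCat.{0} ↥A), Module.Finite ↥A M → Module.Finite ↥A N → ∀ e : CategoryTheory.Abelian.Ext.{0} M N i, (⟨x, hx⟩ : ↥A) • e = 0}; let loc : Subalgebra k K → Subalgebra k K := fun A => Algebra.adjoin k {y : K | ∃ a ∈ A, ∃ s ∈ A, s⁻¹ ∈ O ∧ y = a * s⁻¹}; let chart : Subalgebra k K → Subalgebra k K := fun A => Algebra.adjoin k ((A : Set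 K) ∪ {y : K | ∃ c ∈ ca A, ∃ x ∈ ca A, x ≠ 0 ∧ (∀ c' ∈ ca A, c' * x⁻¹ ∈ O) ∧ y = c * x⁻¹}); let nrm : Subalgebra k K → Subalgebra k K := fun B => Algebra.adjoin k {y : K | IsIntegral ↥B y}; let tower : Subalgebra k K → ℕ → Subalgebra k K := fun A m => @Nat.rec (fun _ => Subalgebra k K) (loc A) (fun _ B => loc (nrm (chart B))) m; let Shape : Subalgebra k K → Prop := fun T => (∃ B : Subalgebra k K, B.FG ∧ B ≤ T ∧ loc B = T ∧ ∀ t ∈ T, ∃ b ∈ B, ∃ s ∈ B, s⁻¹ ∈ O ∧ t = b * s⁻¹) ∧ IsNoetherianRing ↥T ∧ T.toSubring ≤ O.toSubring ∧ ∀ s ∈ T, s⁻¹ ∈ O → s⁻¹ ∈ T; (∀ m : ℕ, Shape (tower A m)) → ∀ m : ℕ, (∃ m' : ℕ, m < m' ∧ ∃ y ∈ ca (tower A m'), y ≠ 0 ∧ ∀ x ∈ ca (tower A m), x ≠ 0 → y * x⁻¹ ∉ O) ∨ ∃ n : ℕ, m ≤ n ∧ tower A (n + 1) = tower A n) → Literature.RingTheory.CohomologyAnnihilator.singEqVCa_essFiniteType.{0}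 → Summit.ResolutionOfSingularities.ResolutionOfSingularities.Theses.HomologicalConductor.StrictDrop := by
  intro hA h54
  have hB := StationaryRegular.stub_stationary_regular h54
  intro p hp k K _ _ _ _ O A hk hfg hfrac hle ca loc chart nrm tower m hm
  have hshape := TowerShape.stub_towerShape p hp k K O A hk hfg hfrac hle
  rcases hA p hp k K O A hk hfg hfrac hle hshape m with hdrop | ⟨n, hmn, hstat⟩
  · exact hdrop
  · have hreg : IsRegularLocalRing ↥(tower A n) :=
      hB p hp k K O A hk hfg hfrac hle hshape n hstat
    have hne : m ≠ n := by
      rintro rfl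
      exact hm hreg
    obtain ⟨y, hy, hy0, hval⟩ :=
      RegularDrop.stub_regular_drop p hp k K O A hk hfg hfrac hle hshape m n hm hreg
    exact ⟨n, lt_of_le_of_ne hmn hne, y, hy, hy0, hval⟩

/-- **Drop-or-freeze from `StrictDrop`** (the converse, so that modulo the named fact the open
stub IS the crux): at a singular stage the crux itself is the left branch; at a regular stage `m`
the tower is stationary, `T_(m+1) = T_m` (landed `NoZeno.Birth.tower_succ_eq_self_of_isRegularLocalRing`,
p-accepted in `Theorems/HomologicalConductorNoZenoIffKernel.lean`, whose `NoZeno.Birth.tower` is the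
route's `let tower` verbatim), which is the right branch with `n := m`. The `Shape` hypothesis is
not needed. [folklore] -/
theorem dropOrFreeze_of_strictDrop (hD : StrictDrop) :
    ∀ p : ℕ, p.Prime → ∀ (k K : Type) [Field k] [CharP k p] [Field K] [Algebra k K] (O : ValuationSubring K) (A : Subalgebra k K), (∀ c : k, algebraMap k K c ∈ O) → A.FG → IsFractionRing ↥A K → A.toSubring ≤ O.toSubring → let ca : Subalgebra k K → Set K := fun A => {x : K | ∃ hx : x ∈ A, ∃ n : ℕ, ∀ i : ℕ, n ≤ i → ∀ (M N : ModuleCat.{0} ↥A), Module.Finite ↥A M → Module.Finite ↥A N → ∀ e : CategoryTheory.Abelian.Ext.{0} M N i, (⟨x, hx⟩ : ↥A) • e = 0}; let loc : Subalgebra k K → Subalgebra k K := fun A => Algebra.adjoin k {y : K | ∃ a ∈ A, ∃ s ∈ A, s⁻¹ ∈ O ∧ y = a * s⁻¹}; let chart : Subalgebra k K → Subalgebra k K := fun A => Algebra.adjoin k ((A : Set K) ∪ {y : K | ∃ c ∈ ca A, ∃ x ∈ ca A, x ≠ 0 ∧ (∀ c' ∈ ca A, c' * x⁻¹ ∈ O)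 ∧ y = c * x⁻¹}); let nrm : Subalgebra k K → Subalgebra k K := fun B => Algebra.adjoin k {y : K | IsIntegral ↥B y}; let tower : Subalgebra k K → ℕ → Subalgebra k K := fun A m => @Nat.rec (fun _ => Subalgebra k K) (loc A) (fun _ B => loc (nrm (chart B))) m; let Shape : Subalgebra k K → Prop := fun T => (∃ B : Subalgebra k K, B.FG ∧ B ≤ T ∧ loc B = T ∧ ∀ t ∈ T, ∃ b ∈ B, ∃ s ∈ B, s⁻¹ ∈ O ∧ t = b * s⁻¹) ∧ IsNoetherianRing ↥T ∧ T.toSubring ≤ O.toSubring ∧ ∀ s ∈ T, s⁻¹ ∈ O → s⁻¹ ∈ T; (∀ m : ℕ, Shape (tower A m)) → ∀ m : ℕ, (∃ m' : ℕ, m < m' ∧ ∃ y ∈ ca (tower A m'), y ≠ 0 ∧ ∀ x ∈ ca (tower A m), x ≠ 0 → y * x⁻¹ ∉ O) ∨ ∃ n : ℕ, m ≤ n ∧ tower A (n + 1) = tower A n := by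
  intro p hp k K _ _ _ _ O A hk hfg hfrac hle ca loc chart nrm tower Shape _hshape m
  by_cases hm : IsRegularLocalRing ↥(tower A m)
  · exact Or.inr ⟨m, le_rfl,
      NoZeno.Birth.tower_succ_eq_self_of_isRegularLocalRing O A hk hfrac hle m hm⟩
  · exact Or.inl (hD p hp k K O A hk hfg hfrac hle m hm)

/-- **Modulo Iyengar–Takahashi 2014 Thm 5.4, drop-or-freeze is EQUIVALENT to the crux
`StrictDrop`.** [folklore] -/
theorem dropOrFreeze_iff_strictDrop
    (h54 : Literature.RingTheory.CohomologyAnnihilator.singEqVCa_essFiniteType.{0}) :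
    (∀ p : ℕ, p.Prime → ∀ (k K : Type) [Field k] [CharP k p] [Field K] [Algebra k K] (O : ValuationSubring K) (A : Subalgebra k K), (∀ c : k, algebraMap k K c ∈ O) → A.FG → IsFractionRing ↥A K → A.toSubring ≤ O.toSubring → let ca : Subalgebra k K → Set K := fun A => {x : K | ∃ hx : x ∈ A, ∃ n : ℕ, ∀ i : ℕ, n ≤ i → ∀ (M N : ModuleCat.{0} ↥A), Module.Finite ↥A M → Module.Finite ↥A N → ∀ e : CategoryTheory.Abelian.Ext.{0} M N i, (⟨x, hx⟩ : ↥A) • e = 0}; let loc : Subalgebra k K → Subalgebra k K := fun A => Algebra.adjoin k {y : K | ∃ a ∈ A, ∃ s ∈ A, s⁻¹ ∈ O ∧ y = a * s⁻¹}; let chart : Subalgebra k K → Subalgebra k K := fun A => Algebra.adjoin k ((A : Set K) ∪ {y : K | ∃ c ∈ ca A, ∃ x ∈ ca A, x ≠ 0 ∧ (∀ c' ∈ ca A, c' * x⁻¹ ∈ O) ∧ y = c * x⁻¹}); let nrm : Subalgebra k K → Subalgebra k K := fun B => Algebra.adjoin k {y : K | IsIntegral ↥B y}; let tower : Subalgebra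 k K → ℕ → Subalgebra k K := fun A m => @Nat.rec (fun _ => Subalgebra k K) (loc A) (fun _ B => loc (nrm (chart B))) m; let Shape : Subalgebra k K → Prop := fun T => (∃ B : Subalgebra k K, B.FG ∧ B ≤ T ∧ loc B = T ∧ ∀ t ∈ T, ∃ b ∈ B, ∃ s ∈ B, s⁻¹ ∈ O ∧ t = b * s⁻¹) ∧ IsNoetherianRing ↥T ∧ T.toSubring ≤ O.toSubring ∧ ∀ s ∈ T, s⁻¹ ∈ O → s⁻¹ ∈ T; (∀ m : ℕ, Shape (tower A m)) → ∀ m : ℕ, (∃ m' : ℕ, m < m' ∧ ∃ y ∈ ca (tower A m'), y ≠ 0 ∧ ∀ x ∈ ca (tower A m), x ≠ 0 → y * x⁻¹ ∉ O) ∨ ∃ n : ℕ, m ≤ n ∧ tower A (n + 1) = tower A n) ↔ StrictDrop :=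
  ⟨fun hA => strictDrop_of_dropOrFreeze hA h54, dropOrFreeze_of_strictDrop⟩

end Summit.ResolutionOfSingularities.ResolutionOfSingularities.Theorems.StrictDrop.Birth.Assembly

end
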